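import Literature.NumberTheory.GaloisCohomology.Howard2004.DVRSettingEngineStub
import Literature.NumberTheory.GaloisCohomology.Howard2004.TransverseCartesianProofs
import HarnessLib

/-!
# Howard 2004, §1.6 on a `DVRSetting`: `Γ_{K_λ}` acts trivially on `T^{(j)}` at the primes `λ ∈ 𝓛^{(j)}`
(the binder `htriv` of the level-`n` Selmer control lemmas, DISCHARGED)

B. Howard, *The Heegner point Kolyvagin system*, Compos. Math. 140 (2004) 1439–1472, §1.2 and §1.6
(arXiv:1202.6340 §2.2, §2.6).  Def. 1.2.1 (arXiv p. 6 L63–68): `𝓛_k(T) = {ℓ ∈ 𝓛₀ : I_ℓ ⊂ p^k ℤ_p}`, i.e.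
`p^k ∣ ℓ + 1` and `Frob_λ ≡ 1` on `T/p^kT`; Def. 1.1.8 / Prop. 1.1.9 and Lemma 1.3.3 / Lemma 1.5.1 are applied in
§1.6 to `(T^{(j)}, F(n), 𝓛^{(j)})`, `𝓛^{(j)} = 𝓛 ∩ 𝓛_{e_j}(T)` (arXiv p. 11 L33–38), under the standing fact that
«`G_{K_λ}` acts trivially on `T^{(j)}`» for `λ ∈ n ∈ 𝓝^{(j)}`: `T` is unramified at `λ ∈ 𝓛 ⊆ 𝓛₀` and
`Frob_λ ≡ 1 (mod p^{e_j})` with `p^{e_j} T^{(j)} = 0`.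

The tree's level-`n` control lemmas (`TransverseCartesianProofs.incH1LE_mem_selmerGroup_atLevel_iff`,
`exists_mem_selmerGroup_atLevel_incH1LE_eq`, `DVRLevelLiftabilityAtLevelProofs…`,
`ResidualLevelControlProofs…`) all take this as the binder
`htriv : ∀ j ≤ m, ∀ w ∈ n, ∀ g ∈ transverseFixer p (residueChar w) jbar w, ∀ y : N j, toLocal w (T.ρ j) g y = y`.
`TransverseCartesianProofs` §4 discharges it from «`I_n` kills `T^{(j)}`» (`toLocal_apply_eq_self_of_ker_eq_bot`,
`htriv_of_levelIdeal_smul_eq_bot`).  This file supplies the forms keyed by Howard's PRIME SETS, which is how §1.6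
(and the tree's ENGINE for Lemma 1.6.4, `DVRSettingEngineStub`) quantifies:

* `DVRSetting.toLocal_apply_eq_self_of_subset_levelPrimes` — all of `Γ_{K_λ}` acts trivially on `T^{(j)}` for
  `λ ∈ n`, `n ⊆ 𝓛^{(j)} = levelPrimes j` (`I_n T^{(j)} = 0`: `ker_π_eq_bot_of_subset_levelPrimes`);
* the binder-shaped corollaries `htriv_of_subset_levelPrimes` (levels `j ≤ m`, key `n ⊆ 𝓛^{(m)}`),
  `htriv_of_subset_enginePrimes` (key `n ⊆ 𝓛^{(2k-1)} = enginePrimes k`, levels with `e_j ≤ 2e_k - 1`: the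
  ENGINE's `hlift` at `e_j = 2e_k - 1` and `hlam` at `i ≤ k`), and `htriv_of_subset_enginePrimes_full` (FULL
  towers `e_i = i + 1`: levels `j ≤ 2k`);
* §3 (append) the residual twin: `Γ_{K_λ}` acts trivially on `T̄` at `λ ∈ n ⊆ 𝓛^{(k)}`
  (`toLocal_ρbar_apply_eq_self_of_subset_levelPrimes`, `htriv_ρbar_of_subset_levelPrimes`).

Theorems only: no definition, no named fact, no instance, no `sorry`.
`thm161_dvrKolyvaginBound` is NOT proved; BSD is not proved by any of this.
-/

set_option autoImplicit false

noncomputable section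

open Function NumberField IsDedekindDomain Field
open scoped NumberField ContRepresentation Classical

namespace Literature.NumberTheory.GaloisCohomology.Howard2004

open Literature.NumberTheory.GaloisRepresentations
open Literature.NumberTheory.GaloisRepresentations.DiscreteGaloisModule

namespace DVRSetting

variable {p : ℕ} [Fact p.Prime] {K : Type} [Field K] [NumberField K]
  {R : Type} [CommRing R] [IsDomain R] [IsDiscreteValuationRing R] [Algebra ℤ_[p] R]
  {N : ℕ → Type} [∀ k, AddCommGroup (N k)] [∀ k, TopologicalSpace (N k)]
  [∀ k, DiscreteTopology (N k)] [∀ k, Module R (N k)]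
  {Rk : ℕ → Type} [∀ k, CommRing (Rk k)] [∀ k, IsLocalRing (Rk k)] [∀ k, TopologicalSpace (Rk k)]
  [∀ k, DiscreteTopology (Rk k)] [∀ k, Algebra ℤ_[p] (Rk k)] [∀ k, Algebra R (Rk k)]
  [∀ k, Module (Rk k) (N k)] [∀ k, IsScalarTower R (Rk k) (N k)]
  {Nbar : Type} [AddCommGroup Nbar] [TopologicalSpace Nbar] [DiscreteTopology Nbar]
  [∀ k, Module (Rk k) Nbar]
  {Nq : ℕ → Finset (HeightOneSpectrum (𝓞 K)) → Type} [∀ k n, AddCommGroup (Nq k n)]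
  [∀ k n, TopologicalSpace (Nq k n)] [∀ k n, DiscreteTopology (Nq k n)]
  [∀ k n, Module (Rk k) (Nq k n)] [∀ k n, Module R (Nq k n)]
  [∀ k n, IsScalarTower R (Rk k) (Nq k n)]

/-! ## §1 `Γ_{K_λ}` acts trivially on `T^{(j)}` at `λ ∈ n ⊆ 𝓛^{(j)}` -/

/-- `𝓛^{(m)} ⊆ 𝓛^{(j)}` for `j ≤ m` (`𝓛_s(T)` is antitone in `s`, `e` is monotone).
[cite: Howard2004HeegnerKolyvagin, §1.6 (arXiv p. 11, L33–38)] -/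
theorem levelPrimes_antitone (S : DVRSetting p K R N Rk Nbar Nq) (hy : S.SatisfiesH) {j m : ℕ} (h : j ≤ m) :
    S.levelPrimes m ⊆ S.levelPrimes j := fun _ hv =>
  ⟨hv.1, S.T.kolyvaginPrimes_antitone p (hy.e_strictMono.monotone h) hv.2⟩

/-- **`Γ_{K_λ}` — all of it — acts trivially on `T^{(j)}` for `λ ∈ n`, `n ⊆ 𝓛^{(j)} = 𝓛 ∩ 𝓛_{e_j}(T)`**
(Howard: «`G_{K_v}` acts trivially on `T`», Def. 1.1.8, for `T^{(j)}` at `λ ∈ n ∈ 𝓝^{(j)}`): `I_n T^{(j)} = 0`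
for such `n` (`ker_π_eq_bot_of_subset_levelPrimes`), so `TransverseCartesianProofs.toLocal_apply_eq_self_of_ker_eq_bot`
applies. [cite: Howard2004HeegnerKolyvagin, Def. 1.1.8, Def. 1.2.1 and §1.6 (arXiv p. 6 L26–31, L63–68; p. 11 L33–38)] -/
theorem toLocal_apply_eq_self_of_subset_levelPrimes (S : DVRSetting p K R N Rk Nbar Nq) (hy : S.SatisfiesH)
    {j : ℕ} {n : Finset (HeightOneSpectrum (𝓞 K))} (hn : ↑n ⊆ S.levelPrimes j) {w : HeightOneSpectrum (𝓞 K)}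
    (hw : w ∈ n) (σ : absoluteGaloisGroup (w.adicCompletion K)) (y : N j) :
    GaloisRep.toLocal w (S.T.ρ j) σ y = y :=
  S.toLocal_apply_eq_self_of_ker_eq_bot hy j (S.mem_levelSet_of_subset_levelPrimes hy j j hn)
    (S.ker_π_eq_bot_of_subset_levelPrimes hy j hn) hw σ y

/-- The same at the key `n ⊆ 𝓛^{(2k-1)} = enginePrimes k` for every level `j` with `e_j ≤ 2e_k - 1`.
[cite: Howard2004HeegnerKolyvagin, §1.6 and Lemma 1.6.3/1.6.4 (arXiv p. 11 L36–38, L69–90)] -/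
theorem toLocal_apply_eq_self_of_subset_enginePrimes (S : DVRSetting p K R N Rk Nbar Nq) (hy : S.SatisfiesH)
    {k j : ℕ} (hj : S.e j ≤ 2 * S.e k - 1) {n : Finset (HeightOneSpectrum (𝓞 K))} (hn : ↑n ⊆ S.enginePrimes k)
    {w : HeightOneSpectrum (𝓞 K)} (hw : w ∈ n) (σ : absoluteGaloisGroup (w.adicCompletion K)) (y : N j) :
    GaloisRep.toLocal w (S.T.ρ j) σ y = y :=
  S.toLocal_apply_eq_self_of_subset_levelPrimes hy (hn.trans (S.enginePrimes_subset_levelPrimes_of_e_le hj))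
    hw σ y

/-! ## §2 The binder `htriv` of the level-`n` control lemmas, discharged -/

/-- **`htriv` for the levels `j ≤ m` at `n ⊆ 𝓛^{(m)}`** — the binder of
`incH1LE_mem_selmerGroup_atLevel_iff` / `exists_mem_selmerGroup_atLevel_incH1LE_eq` /
`exists_mem_selmerGroup_atLevel_eq_scalarMapH1_pow_of_incH1LE_eq` (the transverse fixer `Γ_L ≤ Γ_{K_λ}` acts
trivially on `T^{(j)}`, because all of `Γ_{K_λ}` does).
[cite: Howard2004HeegnerKolyvagin, Lemma 1.3.3 with Lemma 1.5.1 as used in §1.6 (arXiv p. 7 L152–160, p. 11 L33–38, p. 12 L1–9)] -/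
theorem htriv_of_subset_levelPrimes (S : DVRSetting p K R N Rk Nbar Nq) (hy : S.SatisfiesH) {m : ℕ}
    {n : Finset (HeightOneSpectrum (𝓞 K))} (hn : ↑n ⊆ S.levelPrimes m) :
    ∀ j, j ≤ m → ∀ w ∈ n, ∀ g ∈ transverseFixer p (residueChar w) S.jbar w, ∀ y : N j,
      GaloisRep.toLocal w (S.T.ρ j) g y = y :=
  fun _ hj _ hw g _ y =>
    S.toLocal_apply_eq_self_of_subset_levelPrimes hy (hn.trans (S.levelPrimes_antitone hy hj)) hw g y

/-- **`htriv` at the ENGINE's key `n ⊆ 𝓛^{(2k-1)}`** for every level `j` with `e_j ≤ 2e_k - 1` (the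
liftability case reads the level with `e_j = 2e_k - 1`, Lemma 1.6.3; the first case reads the levels `i ≤ k`).
[cite: Howard2004HeegnerKolyvagin, Lemma 1.6.3 and Lemma 1.6.4 (arXiv p. 11 L69–90, p. 12 L1–9)] -/
theorem htriv_of_subset_enginePrimes (S : DVRSetting p K R N Rk Nbar Nq) (hy : S.SatisfiesH) {k : ℕ}
    {n : Finset (HeightOneSpectrum (𝓞 K))} (hn : ↑n ⊆ S.enginePrimes k) :
    ∀ j, S.e j ≤ 2 * S.e k - 1 → ∀ w ∈ n, ∀ g ∈ transverseFixer p (residueChar w) S.jbar w, ∀ y : N j,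
      GaloisRep.toLocal w (S.T.ρ j) g y = y :=
  fun _ hj _ hw g _ y => S.toLocal_apply_eq_self_of_subset_enginePrimes hy hj hn hw g y

/-- `htriv` at the ENGINE's key in the binder shape `∀ j ≤ m` for any top level `m` with `e_m ≤ 2e_k - 1`.
[cite: Howard2004HeegnerKolyvagin, Lemma 1.6.3 and Lemma 1.6.4 (arXiv p. 11 L69–90, p. 12 L1–9)] -/
theorem htriv_of_subset_enginePrimes_of_e_le (S : DVRSetting p K R N Rk Nbar Nq) (hy : S.SatisfiesH) {k m : ℕ}
    (hm : S.e m ≤ 2 * S.e k - 1) {n : Finset (HeightOneSpectrum (𝓞 K))} (hn : ↑n ⊆ S.enginePrimes k) :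
    ∀ j, j ≤ m → ∀ w ∈ n, ∀ g ∈ transverseFixer p (residueChar w) S.jbar w, ∀ y : N j,
      GaloisRep.toLocal w (S.T.ρ j) g y = y :=
  fun j hj => S.htriv_of_subset_enginePrimes hy hn j ((hy.e_strictMono.monotone hj).trans hm)

/-- **`htriv` on a FULL tower** (`e_i = i + 1`, the settings of `thm161_of_full_tame`): at `n ⊆ 𝓛^{(2k-1)}` the
transverse fixers act trivially on every level `j ≤ 2k` (`e_{2k} = 2k + 1 = 2e_k - 1`).
[cite: Howard2004HeegnerKolyvagin, §1.6, Lemma 1.6.3 and Lemma 1.6.4 (arXiv p. 11 L33–38, L69–90)] -/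
theorem htriv_of_subset_enginePrimes_full (S : DVRSetting p K R N Rk Nbar Nq) (hy : S.SatisfiesH)
    (hfull : ∀ i, S.e i = i + 1) {k : ℕ} {n : Finset (HeightOneSpectrum (𝓞 K))} (hn : ↑n ⊆ S.enginePrimes k) :
    ∀ j, j ≤ 2 * k → ∀ w ∈ n, ∀ g ∈ transverseFixer p (residueChar w) S.jbar w, ∀ y : N j,
      GaloisRep.toLocal w (S.T.ρ j) g y = y :=
  S.htriv_of_subset_enginePrimes_of_e_le hy (by rw [hfull, hfull]; omega) hn

/-! ## §3 (append) The residual representation `T̄` at the primes of `n ⊆ 𝓛^{(k)}` -/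

/-- **`Γ_{K_λ}` acts trivially on `T̄ = T/𝔪T` for `λ ∈ n`, `n ⊆ 𝓛^{(k)}` (any level `k`)**: `T̄` is the image of
`T^{(k)}` under the equivariant surjection `π̄_k` (H.1), on which `Γ_{K_λ}` acts trivially (§1).  The residual twin of
the binder `htriv`, read by the residual (`T̄`-level) control and local lemmas of §1.5.
[cite: Howard2004HeegnerKolyvagin, H.1, Def. 1.2.1 and §1.5–1.6 (arXiv p. 7 L59, p. 6 L63–68, p. 11 L33–38)] -/
theorem toLocal_ρbar_apply_eq_self_of_subset_levelPrimes (S : DVRSetting p K R N Rk Nbar Nq) (hy : S.SatisfiesH)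
    {k : ℕ} {n : Finset (HeightOneSpectrum (𝓞 K))} (hn : ↑n ⊆ S.levelPrimes k) {w : HeightOneSpectrum (𝓞 K)}
    (hw : w ∈ n) (σ : absoluteGaloisGroup (w.adicCompletion K)) (x : Nbar) :
    GaloisRep.toLocal w S.ρbar σ x = x := by
  obtain ⟨y, rfl⟩ := (hy.h1 k).1.surjective x
  have h := S.toLocal_apply_eq_self_of_subset_levelPrimes hy hn hw σ y
  rw [GaloisRep.toLocal_apply] at h ⊢
  rw [← (hy.h1 k).1.equivariant, h]

/-- The same at the ENGINE's key `n ⊆ 𝓛^{(2k-1)} = enginePrimes k`.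
[cite: Howard2004HeegnerKolyvagin, H.1 and §1.6 (arXiv p. 7 L59, p. 11 L36–38)] -/
theorem toLocal_ρbar_apply_eq_self_of_subset_enginePrimes (S : DVRSetting p K R N Rk Nbar Nq) (hy : S.SatisfiesH)
    {k : ℕ} {n : Finset (HeightOneSpectrum (𝓞 K))} (hn : ↑n ⊆ S.enginePrimes k) {w : HeightOneSpectrum (𝓞 K)}
    (hw : w ∈ n) (σ : absoluteGaloisGroup (w.adicCompletion K)) (x : Nbar) :
    GaloisRep.toLocal w S.ρbar σ x = x :=
  S.toLocal_ρbar_apply_eq_self_of_subset_levelPrimes hy (hn.trans (S.enginePrimes_subset_levelPrimes hy k)) hw σ x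

/-- The residual twin in the transverse-fixer binder shape (`∀ w ∈ n, ∀ g ∈ Γ_L, ∀ x : T̄, g x = x`).
[cite: Howard2004HeegnerKolyvagin, §1.5–1.6 (arXiv p. 9 L100–104, p. 11 L33–38)] -/
theorem htriv_ρbar_of_subset_levelPrimes (S : DVRSetting p K R N Rk Nbar Nq) (hy : S.SatisfiesH)
    {k : ℕ} {n : Finset (HeightOneSpectrum (𝓞 K))} (hn : ↑n ⊆ S.levelPrimes k) :
    ∀ w ∈ n, ∀ g ∈ transverseFixer p (residueChar w) S.jbar w, ∀ x : Nbar, GaloisRep.toLocal w S.ρbar g x = x :=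
  fun _ hw g _ x => S.toLocal_ρbar_apply_eq_self_of_subset_levelPrimes hy hn hw g x

end DVRSetting

end Literature.NumberTheory.GaloisCohomology.Howard2004

end
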